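import Summits.CriticalPhenomena.SAWScalingLimit.Theorems.SAWSpinMonotoneQCIdentificationNoBranching

/-!
# The exact Gauss–Bonnet integers of the developing map (helper sub-goal (O) of
`stub_rayCondition`, line `eight_fifths_primitive`, crux `QCIdentification`, stmt-CriticalPhenomena-16772)

**What.** Let `Λ` be a simply connected hexagonal domain with boundary source `a = {u_a, v_a}`
(`v_a ∈ Λ`, `u_a ∉ Λ`), `F = Fobs Λ a` its critical parafermionic observable, and assume the no-fold
bound (K) (`NoFoldBound`). The combinatorial Gauss–Bonnet count of the sibling file
`…NoBranching` (the landed stub `stub_noBranching : NoFoldBound → NoBranching`) reads, on the source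
component `Λ₀ = NB.srcComp Λ v_a`,

  `0 = Σ_{s interior} 2π n_s + Σ_{arcs} 2π n_arc`,   `n_s, n_arc : ℕ`,

where at an interior site `s` (full hexagon of `Λ₀`) the six corner angles sum to `2π(1 + n_s)`
(`NB.hexagon_corner_sum`, `NB.typedSum_nonneg_int`), and along a maximal arc
`face s (j+1), …, face s (j+m)` of faces of `Λ₀` around a boundary site `s` the `m` corner angles sum
to `m·π/3 + (5/8)(W(p_out) - W(p_in)) + 2π n_arc` (`NB.arc_lift`; `W = NB.bdryWinding Λ a` the rigid
boundary winding, `p_out = {face s j, face s (j+1)}`, `p_in = {face s (j+1+m), face s (j+m)}` the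
flank mid-edges, whose winding differences telescope, `NB.sum_flank_sub_eq_zero`). The stub exported
only `n_s = 0` (as `NoBranching`). This file exports BOTH vanishing statements as exact real
identities:

* `gb_interior_corner_sum_eq_two_pi` (registered): at a site whose six faces lie in `Λ` with non-zero
  `∂H`-modes, `Σ_j cornerAngle F (face x j) (cornerIdx j) = 2π` — local degree EXACTLY one;
* `gb_arc_corner_sum_exact` (registered): for an arc `face s (j+1), …, face s (j+m)` (`m ≠ 0`) of
  faces of `Λ` with non-zero modes and both flanks `face s j`, `face s (j+1+m)` outside `Λ`,
  `Σ_{i<m} cornerAngle F (face s (j+1+i)) (arcCornerIdx (j+1+i)) = m·π/3 + (5/8)(W(p_out) - W(p_in))`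
  — the integer of `NB.s7_arc_lift` is ZERO for every arc;
* `gb_boundary_phase_exact`: the same identity in the run vocabulary of the assembly
  (`s ∈ NB.bdrySites Λ₀`, `j ∈ NB.runStarts (NB.siteFaces Λ₀ s)`, `m = NB.runLen _ j`): between two
  consecutive boundary ports of `Λ₀` (the in-flank and the out-flank of one arc) the accumulated
  corner excess `Σ_{i<m} (cornerAngle - π/3)` equals `(5/8)(W(p_out) - W(p_in))` on the nose, so that
  phases continued through the corner angles along `∂K_{Λ₀}` follow the rigid winding `-(5/8)W`
  exactly, not only modulo `2π`;
* `gb_sum_bdry_excess_eq_zero`: the total boundary excess of `Λ₀` vanishes.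

**Proof.** Re-run the ledger with the interior integers now known to vanish
(`NB.noBranching_of_noFoldBound`): the face sum `Σ_{v ∈ Λ₀} Σ_k (β_v(k) - π/3) = 0`
(`NB.sum_faces_cornerAngle_sub`) splits into interior sites, contributing `Σ_s typedSum(s) = 0`, and
boundary sites, so the boundary excess is `0`; it is the sum over all arcs of
`E_arc - (5/8) D_arc` plus `(5/8) Σ_arcs D_arc = 0` (telescoping), and every `E_arc - (5/8) D_arc` is
`≥ 0` (`NB.run_excess_ge`), hence each vanishes (`NB.run_excess_eq`). An arc given by its flanks is
the maximal run of `NB.siteFaces Λ₀ s` with pre-flank `j` (`NB.runLen_eq_of_flanks`: faces with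
non-zero modes lie in `Λ₀`, `NB.mem_srcComp_of_modeSum_ne_zero`).

**Why (use).** Step (O) of the stub report `STUB-REPORT-rayCondition.md`: with the branch-consistent
lift of the dart phases on `Λ₀`, these exact integers make the lifted boundary phases of the
`8/5`-primitive `∫ F^{8/5} dz` agree with the rigid winding along the whole boundary, putting all
boundary increments on ONE ray.

Sources: H. Duminil-Copin, S. Smirnov, *The connective constant of the honeycomb lattice equals
`√(2+√2)`*, Ann. of Math. 175 (2012) 1653–1665 (arXiv:1007.0575), Lemma 1 and §3; the degree count
for piecewise linear maps is folklore (discrete Gauss–Bonnet); stub reports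
`STUB-REPORT-noBranching.md` (§2, S7) and `STUB-REPORT-rayCondition.md` ((O)) of this line.
-/

noncomputable section

open Complex
open Literature.Probability.LatticeModels Literature.Probability.RandomPlanarGeometry
open Literature.Probability.RandomPlanarGeometry.SAW
open Literature.Barriers.CriticalPhenomena Literature.Barriers.CriticalPhenomena.HexKernel
open Summit.CriticalPhenomena.SAWScalingLimit.Theses.SAWDevelopingMap

namespace Summit.CriticalPhenomena.SAWScalingLimit.Cruxes.QCIdentification.EightFifthsPrimitive

namespace NB

open Stokes

/-! ### Two pieces of bookkeeping -/

/-- **Squeezing a double sum.** If `Σ_s Σ_j E = 0`, `Σ_s Σ_j D = 0` and `D ≤ E` termwise, then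
`E = D` termwise. -/
theorem eq_of_sum_sum_eq_zero {ι κ : Type*} (S : Finset ι) (T : ι → Finset κ) (E D : ι → κ → ℝ)
    (hE : ∑ s ∈ S, ∑ j ∈ T s, E s j = 0) (hD : ∑ s ∈ S, ∑ j ∈ T s, D s j = 0)
    (hle : ∀ s ∈ S, ∀ j ∈ T s, D s j ≤ E s j) : ∀ s ∈ S, ∀ j ∈ T s, E s j = D s j := by
  have hnn : ∀ s ∈ S, ∀ j ∈ T s, 0 ≤ E s j - D s j :=
    fun s hs j hj => sub_nonneg.2 (hle s hs j hj)
  have hsum : ∑ s ∈ S, ∑ j ∈ T s, (E s j - D s j) = 0 := by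
    simp only [Finset.sum_sub_distrib]
    rw [hE, hD, sub_zero]
  intro s hs j hj
  have h1 := (Finset.sum_eq_zero_iff_of_nonneg fun s hs => Finset.sum_nonneg (hnn s hs)).1 hsum s hs
  exact sub_eq_zero.1 ((Finset.sum_eq_zero_iff_of_nonneg (hnn s hs)).1 h1 j hj)

/-- **An arc given by its flanks is a maximal run.** If `j ∉ J`, `j + 1 + i ∈ J` for `i < m`
(`m ≠ 0`) and `j + 1 + m ∉ J` (`J` a proper subset of `Fin 6`), then `j` is a pre-flank of `J` and
the run it starts has length `runLen J j = m`. -/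
theorem runLen_eq_of_flanks (J : Finset (Fin 6)) (hJ : J ≠ Finset.univ) {j m : Fin 6} (hm : m ≠ 0)
    (hj : j ∉ J) (hin : ∀ i : Fin 6, i < m → j + 1 + i ∈ J) (hout : j + 1 + m ∉ J) :
    j ∈ runStarts J ∧ runLen J j = m := by
  have h0 : (0 : Fin 6) < m := (Fin.pos_iff_ne_zero' m).2 hm
  have hjs : j ∈ runStarts J := mem_runStarts.2 ⟨hj, by simpa using hin 0 h0⟩
  refine ⟨hjs, ?_⟩
  rcases lt_trichotomy (runLen J j) m with h | h | h
  · exact absurd (hin _ h) (add_one_add_runLen_not_mem J hJ j hjs)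
  · exact h
  · exact absurd (mem_of_lt_runLen J j hjs m h) hout

variable {Λ : Finset HexVertex} {ua va : HexVertex}

/-! ### (i) Interior sites: local degree exactly one -/

/-- **(i) The interior Gauss–Bonnet integer vanishes (registered).** Under `NoFoldBound`, in a
simply connected domain `Λ` with boundary source `a`, at every site `x` whose six faces lie in `Λ`
with non-zero `∂H`-modes the six corner angles of the image triangles at `H(x)` sum to EXACTLY `2π`:
the developing map has local degree one (hexagon ledger `NB.s2_hexagon_corner_sum` and
`stub_noBranching`). -/
theorem gb_interior_corner_sum_eq_two_pi : NoFoldBound → ∀ {Λ : Finset HexVertex}, hexDomainSimplyConnected Λ → ∀ {a : Sym2 HexVertex}, a ∈ hexDomainBoundary Λ → ∀ (x : Site 2), (∀ j : Fin 6, HexKernel.face x j ∈ Λ) → (∀ j : Fin 6, modeSum (Fobs Λ a) (HexKernel.face x j) ≠ 0) → ∑ j : Fin 6, cornerAngle (Fobs Λ a) (HexKernel.face x j) (cornerIdx j) = 2 * Real.pi := by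
  intro hK Λ hΛ a ha x hx hS
  rw [hexagon_corner_sum hK hΛ ha x hx hS, noBranching_of_noFoldBound hK Λ hΛ a ha x hx hS, add_zero]

/-! ### The boundary excess of the source component vanishes -/

/-- **The total boundary excess vanishes.** On the source component `Λ₀ = srcComp Λ va` of a simply
connected `Λ` with boundary source `{ua, va}`, under `NoFoldBound`, the angle excesses `β - π/3` of
the corners present at the boundary sites sum to ZERO (face sum `= 0`, interior sites contribute the
typed sums, all zero by `NoBranching`). -/
theorem gb_sum_bdry_excess_eq_zero (hK : NoFoldBound) (hΛ : hexDomainSimplyConnected Λ)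
    (hva : va ∈ Λ) (hua : ua ∉ Λ) (hadj : hexGraph.Adj va ua) :
    ∑ s ∈ (cornerSites (srcComp Λ va)).filter
        (fun s => ¬ ∀ j : Fin 6, HexKernel.face s j ∈ srcComp Λ va),
      ∑ j : Fin 6, (if HexKernel.face s j ∈ srcComp Λ va then
        cornerAngle (Fobs Λ s(ua, va)) (HexKernel.face s j) (arcCornerIdx j) - Real.pi / 3 else 0) =
      0 := by
  have ha : s(ua, va) ∈ hexDomainBoundary Λ := mk_mem_boundary hva hua hadj
  -- the face sum vanishes and splits into interior and boundary sites
  have hsplit := st_sum_corners_split (srcComp Λ va)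
    (fun v k => cornerAngle (Fobs Λ s(ua, va)) v (k + 2) - Real.pi / 3)
  simp only [siteCornerIdx_add_two] at hsplit
  rw [sum_faces_cornerAngle_sub hK hΛ hva hua hadj] at hsplit
  -- interior sites carry the typed sums, all zero
  have hint : ∑ s ∈ (cornerSites (srcComp Λ va)).filter
      (fun s => ∀ j : Fin 6, HexKernel.face s j ∈ srcComp Λ va),
      ∑ j : Fin 6, (cornerAngle (Fobs Λ s(ua, va)) (face s j) (arcCornerIdx j) - Real.pi / 3) = 0 := by
    refine Finset.sum_eq_zero fun s hs => ?_
    have hs6 := (Finset.mem_filter.1 hs).2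
    have hx : ∀ j : Fin 6, face s j ∈ Λ := fun j => srcComp_subset (hs6 j)
    have hS : ∀ j : Fin 6, modeSum (Fobs Λ s(ua, va)) (face s j) ≠ 0 :=
      fun j => modeSum_ne_zero_of_mem_srcComp hK hΛ hua hadj (hs6 j)
    have h2 := hexagon_corner_sum hK hΛ ha s hx hS
    have h0 := noBranching_of_noFoldBound hK Λ hΛ _ ha s hx hS
    rw [Finset.sum_sub_distrib, arcCornerIdx_eq_cornerIdx, h2, h0, Finset.sum_const, Finset.card_univ,
      Fintype.card_fin, nsmul_eq_mul]
    push_cast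
    ring
  rw [hint, zero_add] at hsplit
  exact hsplit.symm

/-! ### (ii) Arcs: the integer of the real lift vanishes -/

/-- **The arc defect vanishes, run form.** At a boundary site `s` of the source component `Λ₀`, for
the arc with pre-flank `j` (length `m = runLen`), the angle excess `Σ_{i<m} (β - π/3)` EQUALS
`(5/8)(W(p_out) - W(p_in))`: the total boundary excess is `0` (`gb_sum_bdry_excess_eq_zero`), it is
the sum over all arcs of the defects `excess - (5/8)(W(p_out) - W(p_in)) ≥ 0` (`NB.run_excess_ge`)
plus `(5/8)` times the telescoping sum `Σ_arcs (W(p_out) - W(p_in)) = 0`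
(`NB.sum_flank_sub_eq_zero`), so every defect vanishes. -/
theorem run_excess_eq (hK : NoFoldBound) (hΛ : hexDomainSimplyConnected Λ)
    (hva : va ∈ Λ) (hua : ua ∉ Λ) (hadj : hexGraph.Adj va ua) {s : Site 2}
    (hs : s ∈ bdrySites (srcComp Λ va)) {j : Fin 6} (hj : j ∈ runStarts (siteFaces (srcComp Λ va) s)) :
    ∑ i ∈ Finset.univ.filter (fun i : Fin 6 => i < runLen (siteFaces (srcComp Λ va) s) j),
        (cornerAngle (Fobs Λ s(ua, va)) (face s (j + 1 + i)) (arcCornerIdx (j + 1 + i)) - Real.pi / 3) =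
      (5 / 8 : ℝ) * (bdryWinding Λ s(ua, va) s(face s j, face s (j + 1)) -
        bdryWinding Λ s(ua, va) s(face s (j + 1 + runLen (siteFaces (srcComp Λ va) s) j),
          face s (j + runLen (siteFaces (srcComp Λ va) s) j))) := by
  -- the total boundary excess, arc by arc
  have hite : ∀ s : Site 2, (∑ j : Fin 6, if HexKernel.face s j ∈ srcComp Λ va then
      cornerAngle (Fobs Λ s(ua, va)) (HexKernel.face s j) (arcCornerIdx j) - Real.pi / 3 else 0) =
      ∑ j ∈ siteFaces (srcComp Λ va) s,
        (cornerAngle (Fobs Λ s(ua, va)) (face s j) (arcCornerIdx j) - Real.pi / 3) := by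
    intro s
    rw [siteFaces, Finset.sum_filter]
  have hE : ∑ s ∈ bdrySites (srcComp Λ va), ∑ j ∈ runStarts (siteFaces (srcComp Λ va) s),
      ∑ i ∈ Finset.univ.filter (fun i : Fin 6 => i < runLen (siteFaces (srcComp Λ va) s) j),
        (cornerAngle (Fobs Λ s(ua, va)) (face s (j + 1 + i)) (arcCornerIdx (j + 1 + i)) -
          Real.pi / 3) = 0 := by
    rw [← gb_sum_bdry_excess_eq_zero hK hΛ hva hua hadj]
    show _ = ∑ s ∈ bdrySites (srcComp Λ va), _
    simp only [hite]
    refine Finset.sum_congr rfl fun s hs => ?_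
    rw [s7_sum_runs (siteFaces (srcComp Λ va) s) (siteFaces_ne_univ (Finset.mem_filter.1 hs).2)]
  -- the flank windings telescope
  have hD : ∑ s ∈ bdrySites (srcComp Λ va), ∑ j ∈ runStarts (siteFaces (srcComp Λ va) s),
      (5 / 8 : ℝ) * (bdryWinding Λ s(ua, va) s(face s j, face s (j + 1)) -
        bdryWinding Λ s(ua, va) s(face s (j + 1 + runLen (siteFaces (srcComp Λ va) s) j),
          face s (j + runLen (siteFaces (srcComp Λ va) s) j))) = 0 := by
    simp only [← Finset.mul_sum]
    rw [sum_flank_sub_eq_zero (srcComp Λ va) (bdryWinding Λ s(ua, va)), mul_zero]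
  -- every defect is `≥ 0`, so every defect vanishes
  exact eq_of_sum_sum_eq_zero (bdrySites (srcComp Λ va)) (fun s => runStarts (siteFaces (srcComp Λ va) s))
    (fun s j => ∑ i ∈ Finset.univ.filter (fun i : Fin 6 => i < runLen (siteFaces (srcComp Λ va) s) j),
      (cornerAngle (Fobs Λ s(ua, va)) (face s (j + 1 + i)) (arcCornerIdx (j + 1 + i)) - Real.pi / 3))
    (fun s j => (5 / 8 : ℝ) * (bdryWinding Λ s(ua, va) s(face s j, face s (j + 1)) -
      bdryWinding Λ s(ua, va) s(face s (j + 1 + runLen (siteFaces (srcComp Λ va) s) j),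
        face s (j + runLen (siteFaces (srcComp Λ va) s) j))))
    hE hD (fun s hs j hj => run_excess_ge hK hΛ hva hua hadj hs hj) s hs j hj

/-- **(ii) The arc Gauss–Bonnet integer vanishes (registered).** Under `NoFoldBound`, in a simply
connected domain `Λ` with boundary source `a`, for every arc `face s (j+1), …, face s (j+m)` (`m ≠ 0`)
of faces of `Λ` with non-zero `∂H`-modes around a site `s`, both flanks `face s j`, `face s (j+1+m)`
outside `Λ`, the sum of the `m` corner angles at `s` is EXACTLY
`m·π/3 + (5/8)(W(p_out) - W(p_in))`, `W = bdryWinding Λ a` the rigid boundary winding,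
`p_out = {face s j, face s (j+1)}`, `p_in = {face s (j+1+m), face s (j+m)}` — the natural number of
`NB.s7_arc_lift` is `0` (the arc is a maximal run of the source component, `run_excess_eq`). -/
theorem gb_arc_corner_sum_exact : NoFoldBound → ∀ {Λ : Finset HexVertex}, hexDomainSimplyConnected Λ → ∀ {a : Sym2 HexVertex}, a ∈ hexDomainBoundary Λ → ∀ (s : Site 2) (j m : Fin 6), m ≠ 0 → HexKernel.face s j ∉ Λ → (∀ i : Fin 6, i < m → HexKernel.face s (j + 1 + i) ∈ Λ) → HexKernel.face s (j + 1 + m) ∉ Λ → (∀ i : Fin 6, i < m → modeSum (Fobs Λ a) (HexKernel.face s (j + 1 + i)) ≠ 0) → ∑ i ∈ Finset.univ.filter (fun i : Fin 6 => i < m), cornerAngle (Fobs Λ a) (HexKernel.face s (j + 1 + i)) (arcCornerIdx (j + 1 + i)) = (m : ℕ) * (Real.pi / 3) + (5 / 8 : ℝ) * (bdryWinding Λ a s(HexKernel.face s j, HexKernel.face s (j + 1)) - bdryWinding Λ a s(HexKernel.face s (j + 1 + m), HexKernel.face s (j + m))) := by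
  intro hK Λ hΛ a ha s j m hm hout hin hout' hS
  obtain ⟨haE, ua, va, rfl, hva, hua⟩ := id ha
  have hadj : hexGraph.Adj va ua := ((SimpleGraph.mem_edgeSet hexGraph).1 haE).symm
  -- the arc lies in the source component, its flanks outside
  have hin0 : ∀ i : Fin 6, i < m → face s (j + 1 + i) ∈ srcComp Λ va :=
    fun i hi => mem_srcComp_of_modeSum_ne_zero hva hua (hin i hi) (hS i hi)
  have hjJ : j ∉ siteFaces (srcComp Λ va) s :=
    fun h => hout (srcComp_subset (mem_siteFaces.1 h))
  have h0 : (0 : Fin 6) < m := (Fin.pos_iff_ne_zero' m).2 hm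
  have hj1 : face s (j + 1) ∈ srcComp Λ va := by simpa using hin0 0 h0
  have hs : s ∈ bdrySites (srcComp Λ va) :=
    Finset.mem_filter.2 ⟨mem_cornerSites_iff.2 ⟨j + 1, hj1⟩, fun h => hjJ (mem_siteFaces.2 (h j))⟩
  have hJ : siteFaces (srcComp Λ va) s ≠ Finset.univ :=
    siteFaces_ne_univ (Finset.mem_filter.1 hs).2
  -- so it is the maximal run with pre-flank `j`, of length `m`
  obtain ⟨hj, hlen⟩ := runLen_eq_of_flanks _ hJ hm hjJ (fun i hi => mem_siteFaces.2 (hin0 i hi))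
    (fun h => hout' (srcComp_subset (mem_siteFaces.1 h)))
  have h := run_excess_eq hK hΛ hva hua hadj hs hj
  rw [hlen, Finset.sum_sub_distrib, Finset.sum_const, card_filter_lt, nsmul_eq_mul,
    sub_eq_iff_eq_add] at h
  rw [h]
  ring

/-- **(O) Exact boundary phases, arc by arc.** Under `NoFoldBound`, on the source component
`Λ₀ = srcComp Λ va` of a simply connected `Λ` with boundary source `{ua, va}` (`va ∈ Λ`, `ua ∉ Λ`,
adjacent): at every boundary site `s` of `Λ₀` and for every arc of faces of `Λ₀` around `s`
(pre-flank `j ∈ runStarts`, length `runLen`), the accumulated corner excess between the two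
consecutive boundary ports `p_in`, `p_out` of `Λ₀` it separates is EXACTLY `(5/8)(W(p_out) - W(p_in))`:
continuing phases through the corner angles along the boundary reproduces the rigid winding
`-(5/8) W` on the nose, not only modulo `2π`. -/
theorem gb_boundary_phase_exact : NoFoldBound → ∀ {Λ : Finset HexVertex}, hexDomainSimplyConnected Λ → ∀ {ua va : HexVertex}, va ∈ Λ → ua ∉ Λ → hexGraph.Adj va ua → ∀ s ∈ bdrySites (srcComp Λ va), ∀ j ∈ runStarts (siteFaces (srcComp Λ va) s), ∑ i ∈ Finset.univ.filter (fun i : Fin 6 => i < runLen (siteFaces (srcComp Λ va) s) j), (cornerAngle (Fobs Λ s(ua, va)) (HexKernel.face s (j + 1 + i)) (arcCornerIdx (j + 1 + i)) - Real.pi / 3) = (5 / 8 : ℝ) * (bdryWinding Λ s(ua, va) s(HexKernel.face s j, HexKernel.face s (j + 1)) - bdryWinding Λ s(ua, va) s(HexKernel.face s (j + 1 + runLen (siteFaces (srcComp Λ va) s) j), HexKernel.face s (j + runLen (siteFaces (srcComp Λ va) s) j))) :=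
  fun hK _ hΛ _ _ hva hua hadj _ hs _ hj => run_excess_eq hK hΛ hva hua hadj hs hj

end NB

end Summit.CriticalPhenomena.SAWScalingLimit.Cruxes.QCIdentification.EightFifthsPrimitive

end
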